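import Literature.NumberTheory.K2Lit.AdelicPlaceSplitting                              -- ★ p855351 (D7′): `splitEquiv`, `splitPlaces`
import Literature.MeasureTheory.RestrictedProduct.Haar                                 -- ★ `rpMeasure` Haar, `borelSpace`, `secondCountableTopology`
import Summits.HodgeConjecture.HodgeConjecture.Theorems.K2LiuAdelicPlaceSplittingFubini   -- ★ p855430 (K2Liu-p04 g2): #21s PAID, tied ED. 2
import Literature.NumberTheory.K2Lit.LocalDoublingUnramifiedHecke                          -- ★ D7d (K2Liu-p04 g2) + D7a∕D7b∕D7c: `iotaLeftLocPi`, `IsDoublingHeckeEigenvector`, `LambdaLoc`, `IsSphericalHeckeEigen` (#28s, ED. 3)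
import Summits.HodgeConjecture.HodgeConjecture.Theorems.K2LiuThetaTypeDoublingEulerFactorGL1  -- ★ p856343 (K2Liu-p01 g3): #30s PAID, tied ED. 5
import Summits.HodgeConjecture.HodgeConjecture.Theorems.K2LiuUnramifiedDoublingHeckeIdentity  -- ★ p856599 (K2Liu-p04 g3): #28s PAID, tied ED. 6
import Summits.HodgeConjecture.HodgeConjecture.Theorems.K2LiuDoublingPartialEuler           -- ★ p856804 (K2Liu-p09 g2): #29s PAID, tied ED. 7

/-!
# K2_Liu_CurveThetaSigs — unit U5b «LOCAL SEAM OF s23» (tier-1 socket module for hLiu418 = stmt-HodgeConjecture-24832)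

Track B ∕ build stream 29 (`Cruxes/HLiu418/Lines/K2_Liu_*`). Planner `hodgecm-mathlib-K2Liu-plan` g0,
2026-09-03. INFO-ONLY companion to the #184♮ LINE `Cruxes/HLiu418/Lines/K2_Liu_CurveThetaNonOrthogonal.lean` (A-plan2 (g33),
rev. h 2a57c13cd04daeeb); sockets of the LOCAL SEAM of s23 `stub_doublingZetaGL1` cut in DEPMAP v2.1 `Cruxes/HLiu418/Lines/K2_Liu_LocalSeam_s23.md`
§§2–4 under the HECKE BYPASS (LEAD «M-154r» Q1: no Flath, no `π_v`, no local `L`-factors as objects; `Z(s) = (∏_{v∉S} c_v(s))·Z_S(s)`).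

ED. 7 (this file; typist g2, 2026-09-04 02:5xZ; TIE-ONLY edition under LEAD F0P6-plan (g10) standing pre-authorisation 01:08:35Z (1), LEAD «PAID READ «=»»
02:36:29Z): #29s `sig_K2LiuDoublingPartialEuler` := ★ `K2LiuDoublingPartialEuler.doublingPartialEuler` (p856804, K2Liu-p09 (g2), ★ 02:33Z, tree 477b26c86fa922f8,
248 l.; the socket's statement verbatim under the payer's `set_option maxHeartbeats 1600000 in` (measured); road: ★ (C0a) `K2LiuDoublingHaarPinned` pinned splitting
of `ν`, ★ (C0c) `K2LiuDoublingEulerLimit` transport ∕ slices ∕ box limit, ★ (B) `K2LiuQuotMatrixCoeffContinuous`, generic core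
`integrable_and_integral_eq_tprod_mul_of_map_eq` read through ★ `placesEmbed S x = (x_∞,1)(1,ι_S x_S)`) (+ import); every `sig_` statement byte-identical to
ED. 6; live `sorry` 1 → 0: **U5b IS SORRY-FREE (4∕4 ★-tied: #21s p855430, #28s p856599, #29s p856804, #30s p856343).**

ED. 6 (typist g2, 2026-09-04 02:2xZ, commit 88c0d16bf0c9 sha16 2501945f4957573f; TIE-ONLY edition under LEAD F0P6-plan (g10) standing pre-authorisation 01:08:35Z (1)): #28s PAID ★ p856599
`Theorems/K2LiuUnramifiedDoublingHeckeIdentity.lean` (K2Liu-p04 (g3), 01:55:23Z, tree aa0419ae15dce9fe, 395 l.; head `…Cruxes.HLiu418.K2LiuUnramifiedDoublingHeckeIdentity.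
unramifiedDoublingHeckeIdentity` = socket bytes VERBATIM (3831 ch token-EQUAL; K2Liu-ref1 (g1) stmtcmp 3555 ch EQUAL), TRIO axioms: Cartan sum over ★ #26-split + ★ #27, GL₂
Hecke eigenvalues by the Tamagawa recursion, sharp coset count `(q+1)q^k`, closed form ★ F3) and TIED BY NAME (import + cast-free `:=`); statement bytes of #21s ∕ #28s ∕
#29s ∕ #30s BYTE-IDENTICAL to ED. 5 e6164a0acdb5df5a (commit a5b1ef69a81c); ONE docstring-only retag (K2Liu-ref1 BOX #29 note N-2-4, count-neutral, announced for this
edition 01:19:16Z): #30s's trailing Liu2011 locator for (2-4) now reads `§2C (2-4) p. 863` (was §2B ∕ p. 862).  SORRIES: 1 (= #29s; K2Liu-p09 (g2) in flight: ★ p856548 (A),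
★ p856556 (B), C0a ∕ C0b proposed).

ED. 5 (typist g2, 2026-09-04 01:12Z): #30s PAID ★ p856343 `Theorems/K2LiuThetaTypeDoublingEulerFactorGL1.lean` (K2Liu-p01 (g3), commit of record on the K2 bus 01:04:59Z; head `…Cruxes.HLiu418.K2LiuThetaTypeDoublingEulerFactorGL1.thetaTypeDoublingEulerFactorGL1` = socket bytes VERBATIM, by-type tie `rfl`, TRIO axioms) and TIED BY NAME (import + cast-free `:=`); statement bytes of #21s ∕ #28s ∕ #29s ∕ #30s BYTE-IDENTICAL to ED. 4 6b9b43282eef5cf1.  SORRIES: 2 (= #28s, #29s).  The last organs of the seam (#31s ∕ #32s ∕ #33s, DEPMAP (LS3)–(LS5)) go to the sibling module U5d `K2_Liu_CurveThetaSigs_U5d_ZetaS.lean` (import weight: ★ `K2Lit/SiegelStandardExtension`, ★ `K2Lit/LocalDoublingZeta`).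

ED. 4 (typist g1, 2026-09-04 01:00Z, commit 6ce256cf651e, sha16 6b9b43282eef5cf1; LEAD GO+BOX #27): ONE NEW SOCKET #30s `sig_K2LiuThetaTypeDoublingEulerFactorGL1` — organ (LS2)(d) «GL₁ SHAPE OF THE UNRAMIFIED EULER
PRODUCT»: the CONSUMER THAT PINS `c` — from per-place closed forms in cleared form over the fibres `{w ∣ v}` (hypothesis (H), uniform in split∕inert `v`; at split
`v` it is #28s's `Num∕a₂` at the θ-type parameters, at inert `v` what #28i must deliver) to `∏'_{v∉S} c_v(s) = [ζ^{S_L}_L · L^{S_L}(·,ψ)](s+½) · B^S(s)` on `Re s > 1` with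
`B^S` holomorphic zero-free on `Re s > 0`; pure GL₁∕`tprod` bookkeeping over ★ `placesNotOverEquivSigma` + ★ #1's M-test engine; `partialZetaL` of the tier-0 line
SPELLED BY VALUE (same summand and index shape as rev. k :256).  ED. 3's blocks (#21s ★-tied, #28s, #29s) BYTE-IDENTICAL.  SORRIES: 3 (= #28s, #29s, #30s).

ED. 3 (typist g1, 2026-09-04 00:39Z, commit 33fdb9fc456d, sha16 5ce39e11c43fdb84; LEAD GO+BOX 00:38:58Z; deals #28s → K2Liu-p04 (g2), #29s → K2Liu-p07 (g2)): TWO NEW SOCKETS. #28s `sig_K2LiuUnramifiedDoublingHeckeIdentity` — organ (LS2) «THE UNRAMIFIED DOUBLING HECKE IDENTITY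
AT A SPLIT GOOD PLACE, n = 2, GENERATOR INTERFACE», typeable now that leaf D7 is ★ (D7a `LocalDoublingEmbedding`, D7b `LocalDoublingZeta`, D7c `LocalDoublingSiegel`,
D7d `LocalDoublingUnramifiedHecke`, all K2Liu-p04 (g2)) and the ORIENTATION is pinned (typist PIN (c2) `K2/K2Liu-plan/g1/PIN-28s-Orientation.K2Liu-plan-g1.md`
5a038a3c2fc21f5c, LEAD GATE «M-154t∕u»; K2Liu-p01 (g2) HINGE READ 00:11:29Z «=»: ★ `heckeTAt` is the ρ-right `w`-component operator, `ev = ν(K_v)·eigenvalue`,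
`a₁ = q^{½}(α+β)`); the eigenvalue is stated in CLEARED-DENOMINATOR form `c · Den₁ · Den₂ = Num` (no junk division; `c` unique since `u ≠ 0`) and was CERTIFIED
NUMERICALLY before typing (`K2/K2Liu-plan/g1/check28s.K2Liu-plan-g1.py` c1c7ab4a1c627cd8: 72 cases — q ∈ {2,3,5}, real and complex `s` down to `Re s = 0.4`, tempered
and non-tempered Satake pairs, `χ_w ≠ χ_w̄` — of `Σ_{m₁≥m₂} Λ(ι(t_m,1))·vol(K t_m K)·ω_β(t_m)` against `Num∕(Den₁Den₂)`, rel. err < 1e-6; the flipped orientation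
misses by 27 %).  #29s `sig_K2LiuDoublingPartialEuler` — organ (LS1)+(LS2) ⇒ (c) «EULER FACTORISATION OF THE DOUBLING ZETA INTEGRAL OFF `S`»:
`Z = (∏'_{v∉S} c_v) · Z_S` over ★ D7b `doublingZeta ∕ zetaS ∕ localZeta ∕ quotMatrixCoeff` for the H-side datum of #13 (bridge `ιA`, general `N, M`), with the local
hypotheses in the SCALAR form the proof uses (factorisation of the pulled-back section off `S`, `K^S`-sphericity of slot 1, the local doubling-Hecke identities for all
translates) — pure measure theory (Tate's Thm 3.3.1 with a vector twist over the ★ restricted-product Haar library), junction-free, dealable now; the dictionary to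
#28s∕★ `IsFactorizableOff`∕★ `localCongr` is the assembly's (#34) and is spelled out in the docstring.  #28i (inert twin of #28s), #30s∕#31s∕#33s after.  SORRIES (ED. 3): 2 (= #28s, #29s).

ED. 2: #21s PAID ★ p855430 `Theorems/K2LiuAdelicPlaceSplittingFubini.lean` (K2Liu-p04 (g2), 7 min after the deal; head byte-identical to ED. 1 :58–:67; extras
`exists_measurePreserving_splitEquiv`, Tonelli∕Fubini through `glueS`, `exists_map_splitPlaces_eq_prod`) and TIED BY NAME (import + cast-free `:=`); module SORRY-FREE until ED. 3 adds #28s∕#29s over leaf D7.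
ED. 1: ONE socket, the first organ of the seam, typeable the moment leaf D7′ ★ p855351 landed —

* #21s `sig_K2LiuAdelicPlaceSplittingFubini` — organ (LS0) «HAAR MEASURE SPLITS AT A FINITE SET OF PLACES»: under ★ `PlaceSplitting.splitEquiv G B S`
  a Haar measure of the restricted product `Πʳ i, [G i, B i]` becomes a PRODUCT `μ_S ⊗ μ^S` of Haar measures on `Π_{i∈S} G i` and on
  `Πʳ_{j∉S} [G j, B j]`; stated GENERICALLY (countably many second-countable locally compact groups with compact open `B i`), so that the
  prover's file is pure measure theory and the ♮ consumers (#29s `DoublingPartialEuler`: `∫_{U(V)(𝔸_f)} = ∫_{U(V)(F_S)} ∫_{U(V)(𝔸_f^S)}`) instantiate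
  it at `G := fun v => UnitaryGroup.localPi … v`, `B := fun v => UnitaryGroup.localInt … v` through ★ `splitPlaces = finAdelicEquiv ≫ splitEquiv`
  (instances by `haveI`: ★ `countable_heightOneSpectrum`, ★ `secondCountableTopology_localPi`, ★ `locallyCompactSpace_localPi`, ★ `isCompact_localInt`).

NOT in ED. 1 (DEFS-before-SIGS; successor's list, DEPMAP v2.1 §4): #28s `sig_K2LiuUnramifiedDoublingHeckeIdentity` and #29s `sig_K2LiuDoublingPartialEuler`
(wait on leaf D7 `K2Lit/LocalDoublingZeta.lean` and on the COMPUTED exponent of file #27 — never a posited `c_v`), #30s (same reason), #31s∕#33s (D7).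

VACUITY ∕ DEGENERATE-CORNER DISCIPLINE (cell rules (V1)–(V7)): #21s carries its corner pass below; measurability structures are Mathlib's `MeasurableSpace.pi`
and the tree's trace σ-algebra ★ `Literature.MeasureTheory.RestrictedProduct.instMeasurableSpace` (generic over the index type, so the `{j // j ∉ S}`-indexed
factor has it); no `BorelSpace` instance is assumed in the bytes (the tree proves it as the theorem ★ `RestrictedProduct.borelSpace`, introduced by `haveI`).
HONEST LABEL: HC_CM is proved only modulo the printed citations (2 remaining named inputs: hLiu418 = stmt-HodgeConjecture-24832, h413 =
stmt-HodgeConjecture-24833) until rung 0 closes; this module is statements only (ED. 7: 0 `sorry` — all four sockets #21s #28s #29s #30s ★-TIED BY NAME; ED. 6: 1; ED. 5: 2; ED. 4: 3; ED. 3: 2; ED. 2: 0), no proof claimed.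
-/

open scoped RestrictedProduct
open MeasureTheory Filter Set

namespace Summit.HodgeConjecture.HodgeConjecture.Cruxes.HLiu418.K2LiuCurveThetaSigsU5bLocalSeam

open Literature.NumberTheory.K2Lit.PlaceSplitting
open NumberField IsDedekindDomain
open Literature.NumberTheory.Automorphic Literature.NumberTheory.GaloisRepresentations
open Literature.NumberTheory.GelbartRogawski1991 Literature.NumberTheory.GelbartRogawski1991.GRConstruction
open Literature.NumberTheory.K2Lit.SiegelDoubled

/-- socket #21s (U5b ED. 1; organ (LS0) «HAAR SPLITS AT FINITELY MANY PLACES»; size M; pure measure theory over ★ p855351 `PlaceSplitting.splitEquiv`;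
dealable NOW to any idle seat (strengths: Haar ∕ measure patching); deps ★ `K2Lit/AdelicPlaceSplitting` (`splitEquiv`, `glueS`, apply lemmas), ★
`Literature/MeasureTheory/RestrictedProduct/Haar` (`borelSpace`, `secondCountableTopology`, `isHaarMeasure_rpMeasure`, `eq_smul_rpMeasure_haar`), Mathlib
`ContinuousMulEquiv.isHaarMeasure_map`, `Measure.prod.instIsHaarMeasure`, `Measure.haarMeasure_unique` ∕ `isMulLeftInvariant_eq_smul`) — **A HAAR MEASURE OF A
RESTRICTED PRODUCT IS A PRODUCT OF HAAR MEASURES ACROSS THE SPLITTING AT A FINITE SET `S`.** Countably many second-countable Hausdorff locally compact groups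
`G i` with COMPACT OPEN subgroups `B i`, a finite set `S` of indices, and a Haar measure `μ` on `Πʳ i, [G i, B i]` (Borel = trace σ-algebra): there are Haar
measures `μ_S` on `Π_{i∈S} G i` and `μ^S` on `Πʳ_{j∉S} [G j, B j]` with `(splitEquiv G B S)_* μ = μ_S ⊗ μ^S`.  Content: the push-forward of `μ` under the
topological-group isomorphism ★ `splitEquiv` is a Haar measure on the product group; on a second-countable locally compact group Haar measure is unique up to
a positive scalar, and `μ_S ⊗ μ^S` (any Haar `μ_S`, `μ^S`) is one — absorb the scalar into `μ_S`.  In s23's local seam this is the Fubini step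
`∫_{U(V)(𝔸_{L⁺,f})} F dν_f = ∫_{U(V)(L⁺_S)} ∫_{U(V)(𝔸_f^S)} F(g_S g^S) dν^S dν_S` behind `Z(s) = (∏_{v∉S} c_v(s))·Z_S(s)` (DEPMAP v2.1 (LS0)–(LS1), file #29),
read through ★ `splitPlaces F E c N J S = finAdelicEquiv ≫ splitEquiv`.
DEGENERATE-CORNER PASS: `S = ∅` ⇒ `Π_{i∈∅} G i` is the trivial (one-point) group, `μ_S` = a positive Dirac mass, `splitEquiv` ≅ the identity on the
second factor ✓ TRUE; `ι` empty or finite ⇒ both restricted products are finite products (all `B`-conditions vacuous cofinitely) ✓; `μ = 0` is excluded by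
`IsHaarMeasure` (positivity on open sets); non-compact `B i` excluded by hypothesis (else `Πʳ` need not be locally compact and `IsHaarMeasure μ` may be
unsatisfiable — then vacuous, not false); (V5): no integral of a user function, only `Measure.map` of a measurable homeomorphism ✓; universe: `ι` and `G i` in
`Type` (the ♮ instance `HeightOneSpectrum (𝓞 L⁺)`, `localPi` live there).  No corner kill found.
Why it might fail: only if the trace σ-algebra ★ `instMeasurableSpace` on `Πʳ_{j∉S}` differed from the Borel σ-algebra of its restricted-product topology
(it does not: ★ `RestrictedProduct.borelSpace` for countable index sets and second-countable factors — the prover invokes it with `haveI` on BOTH restricted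
products) or if `Measure.prod` were taken w.r.t. a non-σ-finite factor (Haar on second-countable locally compact groups is σ-finite).
[cite: CasselsFrohlichANT1967, Ch. XV (Tate) §3.3] [cite: PlatonovRapinchuk1994, §5.1] [cite: BorelJacquet1979, §4.1] -/
theorem sig_K2LiuAdelicPlaceSplittingFubini :
    ∀ {ι : Type} [Countable ι] [DecidableEq ι] (G : ι → Type) [∀ i, Group (G i)] [∀ i, TopologicalSpace (G i)]
      [∀ i, IsTopologicalGroup (G i)] [∀ i, T2Space (G i)] [∀ i, SecondCountableTopology (G i)]
      [∀ i, LocallyCompactSpace (G i)] [∀ i, MeasurableSpace (G i)] [∀ i, BorelSpace (G i)]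
      (B : ∀ i, Subgroup (G i)) [Fact (∀ i, IsOpen (B i : Set (G i)))],
      (∀ i, IsCompact (B i : Set (G i))) →
      ∀ (S : Finset ι) (μ : Measure (Πʳ i, [G i, B i])) [μ.IsHaarMeasure],
      ∃ (μS : Measure (Π i : S, G i.1)) (μ' : Measure (Πʳ j : {i // i ∉ S}, [G j.1, B j.1])),
        μS.IsHaarMeasure ∧ μ'.IsHaarMeasure ∧
          Measure.map (splitEquiv G B S) μ = μS.prod μ' :=
  Summit.HodgeConjecture.HodgeConjecture.Cruxes.HLiu418.K2LiuAdelicPlaceSplittingFubini.adelicPlaceSplittingFubini -- ★ PAID p855430 (K2Liu-p04 g2), tied ED. 2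

/-- socket #28s (U5b ED. 3; organ (LS2) «UNRAMIFIED DOUBLING HECKE IDENTITY, SPLIT GOOD PLACE, n = 2, GENERATOR INTERFACE»; size M–L; OWNER K2Liu-p04 (g2) (author of
leaf D7 and of file #27 `Theorems/K2LiuUnramifiedSectionOnCartan.lean`, REPORT-FIRST 00:03:14Z; interface agreed 00:06:27Z + erratum 00:07:02Z); deps ★ D7a `iotaLeftLocPi`,
★ D7b `doublingHeckeOp ∕ IsDoublingHeckeEigenvector`, ★ D7c `LambdaLoc ∕ lambdaLoc_mul_eq ∕ lambdaLoc_iotaLeft_mul_localInt ∕ lambdaLoc_iotaLeft_localInt_mul` (bi-`K_v`-invariance),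
★ D7d `IsSphericalHeckeEigen ∕ IsCartanFamily ∕ cLoc`, #27 (the closed form of `Λ_{s,v}` on diagonal Cartan elements), ★ O41.5 (4c) `K2LiuSphericalSectionLambdaLoc.exists_isSiegelIntDecomp`
(no junk value of `Λ_{s,v}` at a good place), ★ `UnitaryGroup.localPiSplitEquiv ∕ localPiSplitEquiv_symm_mem_localInt_iff` (`U(V)(L⁺_v) ≅ GL₂(L_w)`, `K_v ≅ GL₂(𝒪_w)`), the
`GL₂` Cartan decomposition and spherical Hecke algebra `ℂ[K t₁ K, (K t₂ K)^{±1}]` (Macdonald), ★ `HeckeCharacter.localComponent_eq_valueAtUniformizer`) — **THE HECKE FORM OF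
THE UNRAMIFIED LOCAL DOUBLING COMPUTATION [Li1992 Thm. 3.1], [GPSR87 Part A §6], [Liu2011 (2-4)], IN THE TREE'S ORIENTATION ε = +1.**  Frame: the K2Lit datum
`(e, dV, dW)` with `(N, M) = (2, 1)` (the CURVE case of hLiu418: `G_v = U(V)(L⁺_v)`, `dim_L V = 2`, doubled group `H_v = U(𝕎 ⊕ −𝕎)(L⁺_v)` of ★ `hermD`), a finite place `v` of
`L⁺` SPLIT in `L` (`w ∣ v`, `c w ≠ w`) and GOOD: `2 ∈ 𝒪^×` above `v`, the entries `dV i` units above `v` (so `K_v := ★ localInt ↦ GL₂(𝒪_w)` under ★ `localPiSplitEquiv`), the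
real Gram matrix ★ `gramR` and its inverse integral above `v` (★ (4c)'s hypotheses verbatim: every `h ∈ H_v` is `p·k`, `Λ_{s,v}` takes no junk value); `χ` a UNITARY Hecke
character of `L` unramified above `v`; `Re s > 0`.  A Haar measure `ν` on `G_v` with `ν(K_v) = 1`; two elements `t₁, t₂ ∈ G_v` pinned by their `w`-COMPONENTS `diag(ϖ_w, 1)` and
`ϖ_w·1₂` (`ϖ_w` = ★ `HeckeCharacter.uniformizer L w`; through the split frame these are ★ `heckeElementAt w … ϖ 1` and the centre, K2Liu-p01 HINGE READ (i)); a Banach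
representation `τ : G_v →* (V →L[ℂ] V)` that is strongly continuous and CONTRACTIVE (`‖τ g‖ ≤ 1`, e.g. right translation on the Weil∕`L²`∕sup-norm carriers of s23), a vector
`u ≠ 0` that is a `K_v`-SPHERICAL HECKE EIGENVECTOR for the generator family `![t₁, t₂]` with eigenvalues `![a₁, a₂]` (★ D7d `IsSphericalHeckeEigen`: `K_v`-fixed, Bochner
`∫_{K_v t_i K_v} τ g u dν = a_i • u`).  CONCLUSION: `u` is an eigenvector of the doubling Hecke operator of the kernel `Λ_{s,v} ∘ ι_v(·,1)` (★ D7b `IsDoublingHeckeEigenvector`,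
with CONVERGENCE of `∫_{G_v} Λ_{s,v}(ι_v(g,1)) • τ(g) u dν` as part of the claim) with an eigenvalue `c` satisfying, with `q := N(w)` (★ `residueCard`), `χ_w := χ(ϖ_w)`,
`χ_w̄ := χ(ϖ_{c⁻¹w})` (★ `valueAtUniformizer`), `χ⁰ := χ_w·χ_w̄` (`= χ|_{L⁺}(ϖ_v)` at a split place):
  `c · (1 − χ_w·a₁·q^{−(s+1)} + χ_w²·a₂·q^{−(2s+1)}) · (a₂ − χ_w̄·a₁·q^{−(s+1)} + χ_w̄²·q^{−(2s+1)}) = a₂ · (1 − χ⁰·q^{−(2s+2)}) · (1 − χ⁰·q^{−(2s+1)})`,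
i.e. `c = c_v(s) = L_v(s+½, BC(σ_v) ⊗ χ_v) ∕ b_{2,v}(s, χ)` written in the generators: with `X := q^{−(s+½)}` and the unitary Satake pair `{β₁, β₂}` of `u` (`a₁ = q^{½}(β₁+β₂)`,
`a₂ = β₁β₂` at `ν(K_v) = 1`), `Den₁ = ∏ᵢ(1 − χ_wβᵢX)`, `Den₂ = a₂·∏ᵢ(1 − χ_w̄βᵢ⁻¹X)`, `Num∕a₂ = b_{2,v}(s,χ)⁻¹ = (1 − χ⁰q^{−2s−2})(1 − χ⁰q^{−2s−1})` (`ε_{L∕L⁺,v} = 1` at split `v`)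
[Liu2011 (2-4) p. 863, Rem. 2.4; Li1992 Thm. 3.1; HKS96 (6.12)–(6.13)].  ORIENTATION (PIN (c2), numbers): by (#27) `Λ_{s,v}(ι_v(t_m,1)) = χ_w^{M⁺}·χ_w̄^{M⁻}·q^{−(s+1)(M⁺+M⁻)}`
(`t_m` of `w`-component `diag(ϖ^{m₁}, ϖ^{m₂})`, `M^± = Σ (±mᵢ)⁺`), so `χ_w` rides with the POSITIVE powers of `ϖ_w` and with `a₁`'s linear term — «⊗ χ» and not «⊗ χ⁻¹»;
the typist's certificate `check28s` sums `Σ_{m₁≥m₂} Λ(ι(t_m,1))·vol(K t_m K)·ω_β(t_m)` (GL₂ Macdonald) and matches `Num∕(Den₁Den₂)` to 1e-6 in 72 cases while the flipped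
orientation misses by 27 %.  WHY CLEARED DENOMINATORS: `c` is the genuine operator eigenvalue (unique as `u ≠ 0`); `Σ_m |Λ(t_m)|·vol(K t_m K) < ∞` exactly for `Re s > 0`
(worst ray `m = (k,−k)`: `q^{−2k·Re s}`), the contraction bound gives `|a_m| ≤ vol`, so `s ↦ c(s)` is holomorphic on `Re s > 0` and `c·Den₁Den₂ = Num` there by analytic
continuation from `Re s ≫ 0` — true even where `Den₁Den₂` happens to vanish, which a quotient form would misstate (Lean `x ∕ 0 = 0`).  HOW #29s∕#30s CONSUME IT: at the
places `v ∉ S` of s23 (`χ = χ_D = toHeckeCharacter L lam⁻¹`, PACKAGE (B); `u` = the `K_v`-component vector of the P-family with S3's `{β₁,β₂} = {λ̃_w, λ̃_w⁻¹χ̌_w}`,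
★ `Liu2021.lemD1_splitPlace_heckeEigenvalues_muCarrier`) `Den₁Den₂ ≠ 0` on `Re s > ½` trivially (`|βᵢ| = 1`) and `∏_{v∉S} c_v = ζ^S_L(s+½)·L^S(s+½, λ̃⁻²χ̌) ∕ b^S` ((d) of
DEPMAP v2.2 §7); inert good places need only «`c_v` holomorphic and non-zero near `½`» (#28i, later, smaller).
DEGENERATE-CORNER PASS: `u = 0` EXCLUDED by `hu` (else `IsSphericalHeckeEigen` holds for arbitrary `a₁ a₂` and `∃ c, c·Den = Num` fails when `Den = 0 ≠ Num`) ✓; `a₂ = 0` is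
impossible under the hypotheses (`K t₂ K = t₂K`, `ν(K)=1`, `u` fixed ⇒ `a₂•u = τ(t₂)u`, `τ(t₂)` invertible) ✓; `V` not complete is excluded by `[CompleteSpace V]` (else every
Bochner integral is junk `0` and the eigen-equations force `a_i = 0`) ✓; non-unitary `χ` excluded by `hχu` (else the abscissa moves) ✓; `ν(K_v) ≠ 1` excluded by `hνK` (else
`a_i` rescale by `ν(K_v)` and `Num` needs `ν(K_v)²`, K2Liu-p01 HINGE (ii)) ✓; (V5) every integral is Bochner in the Banach space `V` with its measurability supplied: `g ↦ τ g u`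
continuous (`hτc`), `Λ_{s,v}∘ι_v(·,1)` locally constant (bi-`K_v`-invariant, `K_v` open) on a `BorelSpace` ✓; `t₁`, `t₂` exist (★ `localPiSplitEquiv` is onto) so the `∀ t₁ t₂`
is not vacuous ✓; `n` (the index of `e`) is forced to `2` by `e : Fin 2 × Fin 1 ≃ Fin n` up to the equivalence — all carriers are stated over `e`, no `n = 2` rewrite needed ✓.
Why it might fail: only through a NORMALISATION slip — the `q^{−(s+1)}` of the linear terms is `q^{−½}·X` with `a₁` in the `ν(K_v) = 1` currency (`a₁ = q+1` for the trivial
representation; certificate case), and ★ D7c's `siegelDeltaCharacter` exponent `s + n∕2 = s + 1` — both exercised by `check28s`; or if ★ `localInt` at a good split place were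
smaller than `GL₂(𝒪_w)` (it is not: ★ `localPiSplitEquiv_symm_mem_localInt_iff` under `hdVw`).
[cite: Li1992, §3 Thm. 3.1] [cite: GelbartPiatetskishapiroRallis1987, Part A §6] [cite: Liu2011, §2C (2-4) p. 863] [cite: HarrisKudlaSweet1996, §6 (6.12)–(6.13)] [cite: Macdonald1971, Ch. V (1.2)] -/
theorem sig_K2LiuUnramifiedDoublingHeckeIdentity :
    ∀ (L : Type) [Field L] [NumberField L] [IsCMField L] {n : ℕ} (e : Fin 2 × Fin 1 ≃ Fin n)
      (dV : Fin 2 → L) (hdV : ∀ i, IsCMField.complexConj L (dV i) = dV i) (_hdV0 : ∀ i, dV i ≠ 0)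
      (dW : Fin 1 → L) (hdW : ∀ i, IsCMField.complexConj L (dW i) = dW i) (_hdW0 : ∀ i, dW i ≠ 0)
      (v : HeightOneSpectrum (𝓞 (Fp L)))
      -- a SPLIT place of good reduction for `(V, χ)`
      (w : UnitaryGroup.PlacesOver L v) (_hw : IsCMField.complexConj L • w.1 ≠ w.1)
      (_h2 : ∀ w' : UnitaryGroup.PlacesOver L v, ValuativeRel.valuation (w'.1.adicCompletion L) (2 : w'.1.adicCompletion L) = 1)
      (_hdVw : ∀ (w' : UnitaryGroup.PlacesOver L v) (i : Fin 2),
        ValuativeRel.valuation (w'.1.adicCompletion L) (algebraMap L (w'.1.adicCompletion L) (dV i)) = 1)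
      (_hT : ∀ (w' : UnitaryGroup.PlacesOver L v) (i j : Fin n), ValuativeRel.valuation (w'.1.adicCompletion L)
        (algebraMap L (w'.1.adicCompletion L) (algebraMap (Fp L) L (gramR L e dV hdV dW hdW i j))) ≤ 1)
      (_hTinv : ∀ (w' : UnitaryGroup.PlacesOver L v) (i j : Fin n), ValuativeRel.valuation (w'.1.adicCompletion L)
        (algebraMap L (w'.1.adicCompletion L) (algebraMap (Fp L) L ((gramR L e dV hdV dW hdW)⁻¹ i j))) ≤ 1)
      (χ : HeckeCharacter L) (_hχu : χ.IsUnitary) (_hχ : ∀ w' : UnitaryGroup.PlacesOver L v, χ.IsUnramifiedAt w'.1)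
      (s : ℂ) (_hs : 0 < s.re)
      -- Haar measure on `G_v = U(V)(L⁺_v)` normalised by `ν(K_v) = 1`
      [MeasurableSpace (UnitaryGroup.localPi L (IsCMField.complexConj L) 2 (Matrix.diagonal dV) v)]
      [BorelSpace (UnitaryGroup.localPi L (IsCMField.complexConj L) 2 (Matrix.diagonal dV) v)]
      (ν : Measure (UnitaryGroup.localPi L (IsCMField.complexConj L) 2 (Matrix.diagonal dV) v)) [ν.IsHaarMeasure]
      (_hνK : ν (UnitaryGroup.localInt L (IsCMField.complexConj L) 2 (Matrix.diagonal dV) v :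
          Set (UnitaryGroup.localPi L (IsCMField.complexConj L) 2 (Matrix.diagonal dV) v)) = 1)
      -- the two Hecke generators, pinned by their `w`-components
      (t₁ t₂ : UnitaryGroup.localPi L (IsCMField.complexConj L) 2 (Matrix.diagonal dV) v)
      (_ht₁ : (((t₁ : UnitaryGroup.LocalGLPi L 2 v) w : GL (Fin 2) (w.1.adicCompletion L)) : Matrix (Fin 2) (Fin 2) (w.1.adicCompletion L)) =
        Matrix.diagonal ![(HeckeCharacter.uniformizer L w.1 : w.1.adicCompletion L), 1])
      (_ht₂ : (((t₂ : UnitaryGroup.LocalGLPi L 2 v) w : GL (Fin 2) (w.1.adicCompletion L)) : Matrix (Fin 2) (Fin 2) (w.1.adicCompletion L)) =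
        Matrix.diagonal ![(HeckeCharacter.uniformizer L w.1 : w.1.adicCompletion L), (HeckeCharacter.uniformizer L w.1 : w.1.adicCompletion L)])
      -- a contractive, strongly continuous Banach representation and a non-zero spherical Hecke eigenvector
      {V : Type} [NormedAddCommGroup V] [NormedSpace ℂ V] [CompleteSpace V]
      (τ : UnitaryGroup.localPi L (IsCMField.complexConj L) 2 (Matrix.diagonal dV) v →* (V →L[ℂ] V))
      (_hτc : ∀ x : V, Continuous fun g => τ g x) (_hτb : ∀ g, ‖τ g‖ ≤ 1)
      (u : V) (_hu : u ≠ 0) (a₁ a₂ : ℂ)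
      (_heig : IsSphericalHeckeEigen ν (UnitaryGroup.localInt L (IsCMField.complexConj L) 2 (Matrix.diagonal dV) v) ![t₁, t₂] (fun g => τ g) u ![a₁, a₂]),
      ∃ c : ℂ,
        IsDoublingHeckeEigenvector ν (fun g => LambdaLoc L e dV hdV dW hdW v χ s (iotaLeftLocPi L e dV hdV dW hdW v g)) (fun g => τ g) u c ∧
        c * ((1 - χ.valueAtUniformizer w.1 * a₁ * (w.1.residueCard : ℂ) ^ (-(s + 1)) +
                χ.valueAtUniformizer w.1 ^ 2 * a₂ * (w.1.residueCard : ℂ) ^ (-(2 * s + 1))) *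
              (a₂ - χ.valueAtUniformizer (UnitaryGroup.PlacesOver.galInv (IsCMField.complexConj L) w).1 * a₁ * (w.1.residueCard : ℂ) ^ (-(s + 1)) +
                χ.valueAtUniformizer (UnitaryGroup.PlacesOver.galInv (IsCMField.complexConj L) w).1 ^ 2 * (w.1.residueCard : ℂ) ^ (-(2 * s + 1)))) =
          a₂ * (1 - χ.valueAtUniformizer w.1 * χ.valueAtUniformizer (UnitaryGroup.PlacesOver.galInv (IsCMField.complexConj L) w).1 *
                  (w.1.residueCard : ℂ) ^ (-(2 * s + 2))) *
            (1 - χ.valueAtUniformizer w.1 * χ.valueAtUniformizer (UnitaryGroup.PlacesOver.galInv (IsCMField.complexConj L) w).1 *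
                  (w.1.residueCard : ℂ) ^ (-(2 * s + 1))) :=
  K2LiuUnramifiedDoublingHeckeIdentity.unramifiedDoublingHeckeIdentity

set_option maxHeartbeats 2000000 in -- the adelic unitary datum's product structure + the doubled group's telescope
/-- socket #29s (U5b ED. 3; organ (LS1)+(LS2) ⇒ (c) «EULER FACTORISATION OF THE DOUBLING ZETA INTEGRAL OFF `S`»; size M–L; PURE MEASURE THEORY over
★ D7b `doublingZeta ∕ zetaS ∕ localZeta ∕ quotMatrixCoeff` and the ★ restricted-product Haar library — dealable NOW to any idle seat (strengths: Haar, Fubini,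
dominated convergence; the author of #21s ★ `K2LiuAdelicPlaceSplittingFubini` is the natural owner); deps ★ `UnitaryGroup.adelicProdEquiv ∕ archPart ∕ finPart ∕
evalPlace ∕ inclPlaceAdelic ∕ finAdelicEquiv ∕ localInt`, ★ `UnitaryGroup.exists_isHaarMeasure_arch_eq_map_prod_rpMeasure` (`ν_𝔸 = ν_∞ ⊗ ∏'_v (ν_v ; K_v)` for ANY
Haar `ν_𝔸` once `ν_v(K_v) = 1` off `S`), ★ `Literature.MeasureTheory.RestrictedProduct.{setIntegral_rpBox_eq_prod, tendsto_prod_integral_of_forall_rpBox,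
lintegral_eq_iSup_prod_of_forall_rpBox, integral_comp_glue_prod}` (Tate's Thm 3.3.1 for scalar factorizable functions), ★ #21s, ★ D7b `placesEmbed ∕ zetaS ∕
ZetaSConverges ∕ localZeta`, ★ `K2Lit/DoublingZetaIntegral` (`doublingZeta`, `quotMatrixCoeff`), ★ #14bR (`quotMatrixCoeffBound`: `|⟨π(t)φ₁,φ₂⟩| ≤ ‖φ₁‖₂‖φ₂‖₂`)) —
**`Z = (∏_{v∉S} c_v) · Z_S` FOR A SECTION FACTORIZABLE OFF `S` AGAINST A `K^S`-SPHERICAL VECTOR THAT IS A LOCAL DOUBLING-HECKE EIGENVECTOR AT EVERY `v ∉ S`**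
[Liu2011 §2B Prop. 2.3 p. 862 in HECKE FORM; PSR87 Part A §1; Li1992 §3], stated for the H-side datum of #13 (`𝒢 = U(H)`, bridge `ιA : U(H)(𝔸) →* U(diag dV)(𝔸)`,
general `N, M`) with the local hypotheses in the SCALAR, junction-free form the proof uses.  DATA: a finite set `S` of finite places of `L⁺`; a Haar measure `ν` on
`G(𝔸) = U(H)(𝔸_{L⁺})` (the one #13 produces) and local Haar measures `ν_v` on `G_v = U(H)(L⁺_v)` with `ν_v(K_v) = 1` for `v ∉ S` (`K_v` = ★ `localInt`); THEN there
is a Haar measure `ν_∞` on `G_∞` (depending on `ν, (ν_v), S` ONLY — so that `Z_S(s)` below is taken against FIXED measures for a whole family `s ↦ f_s`, as (LS5)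
holomorphy needs) such that for every automorphic measure `μ` on the compact quotient `[G]`, bridge `ιA`, section `f : H(𝔸) → ℂ`, continuous `φ₁ φ₂ : [G] → ℂ`, head
`F_S : G_∞ × G_S → ℂ`, local kernels `Λ_v : G_v → ℂ` and scalars `c_v` satisfying
 (F) FACTORISATION OFF `S` of the pulled-back section: `f(ι(ιA t, 1)) = F_S(t_∞, (t_v)_{v∈S}) · ∏ᶠ_{v∉S} Λ_v(t_v)` for all `t ∈ G(𝔸)`;
 (Λ) for `v ∉ S`: `Λ_v ≡ 1` on `K_v`, `Λ_v ∈ L¹(ν_v)`, and the partial products `∏_{v∈T} ∫|Λ_v| dν_v` (`T ⊆ {v ∉ S}` finite) are BOUNDED (⇔ `∏_v ∫|Λ_v|` converges, all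
     factors being `≥ ν_v(K_v) = 1`);
 (I) `t ↦ f(ι(ιA t,1))` is continuous and `ν`-integrable (★ #14a∕#16's conclusion, transported along `ιA`);
 (K) `K^S`-SPHERICITY of slot 1: `⟨π(t k)φ₁, φ₂⟩ = ⟨π(t)φ₁, φ₂⟩` for every `k` with `k_∞ = 1`, `k_v ∈ K_v` for all `v` and `k_v = 1` for `v ∈ S` (★ `quotMatrixCoeff`,
     tree convention `(π(t)φ)(x) = φ(t⁻¹ • x)`);
 (E) LOCAL DOUBLING-HECKE IDENTITIES, scalar form, all translates: `∫_{G_v} Λ_v(g) ⟨π(t · ι_v(g))φ₁, φ₂⟩ dν_v(g) = c_v · ⟨π(t)φ₁, φ₂⟩` for `v ∉ S`, `t ∈ G(𝔸)` (★ D7b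
     `localZeta`; `ι_v` = ★ `inclPlaceAdelic v`),
one has: `Z_S` converges absolutely (★ `ZetaSConverges … ν_∞ (ν_v)_{v∈S}`) and **`Z = (∏'_{v∉S} c_v) · Z_S`** (★ `doublingZeta … ν` = `(∏' c_v) *` ★ `zetaS … ν_∞ (ν_v)_{v∈S}`).
PROOF ROAD (Tate 3.3.1 with a vector twist): `ν ≅ ν_∞ ⊗ (⊗_{v∈S} ν_v) ⊗ ∏'_{v∉S}(ν_v; K_v)` along ★ `adelicProdEquiv` ∕ ★ `splitPlaces S` (★ `exists_isHaarMeasure_arch_eq_map_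
prod_rpMeasure` + ★ #21s + ★ `eq_smul_rpMeasure_haar`; the scalar goes into `ν_∞`); for fixed `x = (t_∞, t_S)` the inner integral over the box `A_T = ∏_{v∈T} G_v × ∏_{v∉S∪T} K_v`
is `∫ ∏_{v∈T} Λ_v(g_v) ⟨π(x·g_T·k)φ₁, φ₂⟩ = (∏_{v∈T} c_v) · ⟨π(x)φ₁, φ₂⟩` ((K) kills `k` — the `K`-part has mass `1` —, then (E) place by place, innermost variable first;
finite Fubini is licit since `Λ_v ∈ L¹` and `|⟨π(·)φ₁,φ₂⟩| ≤ ‖φ₁‖₂‖φ₂‖₂`, ★ #14bR); `T ↑` by dominated convergence with dominator `|F_S| ⊗ ∏_v|Λ_v| · ‖φ₁‖₂‖φ₂‖₂ ∈ L¹` ((I) +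
Tonelli give `F_S ∈ L¹(ν_∞ ⊗ ν_S)`, (Λ) gives `∏_v |Λ_v| ∈ L¹` of the restricted product with integral `∏_v ∫|Λ_v|`); the products `∏_{v∈T} c_v` converge to `∏' c_v` whenever
`⟨π(x)φ₁,φ₂⟩ ≠ 0` for some `x` (then `|c_v − 1| ≤ C ∫_{G_v∖K_v}|Λ_v|`, summable by (Λ)), and when `⟨π(·)φ₁,φ₂⟩ ≡ 0` both sides vanish (Lean's junk `∏' = 1` is then harmless);
finally `f(ι(ιA(placesEmbed x),1)) = F_S(x)` because `Λ_v(1) = 1`, which is ★ `zetaS`'s integrand.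
HOW #34 CONSUMES IT (dictionary, all ★): `Λ_v(g) := Λ_{s,v}((ι(ιA ι_v(g), 1))_v)` = ★ D7c `LambdaLoc v χ_D s` ∘ ★ D7a `iotaLeftLocPi v` ∘ ★ `localCongr_v` (`(ιA t)_v = B_v t_v B_v⁻¹`
from #13's `hιA`, ★ `UnitaryGroupLocalCongr.evalPlace_finAdelicCongr`; ★ D7a `evalPlace_iotaLeftFin`: the `v`-component of `ι(h,1)` is `ι_v(h_v,1)`), so (F) is ★ D7d
`IsFactorizableOff S χ_D f fS` read at `h = ι(ιA t, 1)` and (Λ)'s `Λ_v|_{K_v} = 1` is ★ `lambdaLoc_of_mem_localInt`; (E) is #28s (vector form, ★ `IsDoublingHeckeEigenvector`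
in the Banach model `V = P.space`, `τ = P.space.toContRep ∘ ι_v`, `u = w`) pushed through the continuous functional `ℓ_t = ⟨π(t)·, φ₂⟩` by ★ D7b
`localZeta_eq_of_isDoublingHeckeEigenvector`, the spherical eigenvalues `(a₁, a₂)` coming from (LS2) (★ `Liu2021.rhoVAtLine_congr_heckeTAt_apply_eq_smul` transported along
the frame's `j`); (K) is `w ∈ π^{K^S}` (★ `DiscreteAutomorphicRep.toContRep_inclPlaceAdelic_apply_eq_self_…`-type facts); (I) is ★ #14a + ★ #16; the bound in (Λ) and
`Multipliable c` come from the EXPLICIT `c_v` of #28s∕#28i (#30s: `∏ c_v = ζ^S_L(s+½)L^S(s+½,ψ)∕b^S`, convergent for `Re s > 1`, whence s23's `s₁ ≥ 1`).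
DEGENERATE-CORNER PASS: `S = ∅` ✓ (`G_S` trivial, `Z_S = ∫_{G_∞}`); `N = 0` ✓ (all groups trivial, `Z = Z_S·∏' c_v` with every `c_v` forced to `1` or `⟨φ₁,φ₂⟩ = 0`);
`φ₁ = 0` or `⟨π(·)φ₁,φ₂⟩ ≡ 0` ✓ (`0 = (∏' c)·0`, `c` unconstrained — the identity does not pin `c`, #30s does); `Λ_v` non-measurable EXCLUDED by `Λ_v ∈ L¹(ν_v)` (Mathlib
`Integrable` carries a.e.-strong measurability; without it (E) and `Z` would be junk-`0` equations); `F_S` non-measurable EXCLUDED by (F)+(I): `F_S = (f∘ι∘ιA)∘placesEmbed`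
(`Λ_v(1)=1`) is continuous (★ `continuous_placesEmbed`); `ν_v(K_v) ≠ 1` at some `v ∉ S` excluded by `hνK` (else `∏'(ν_v;K_v)` is not a measure of mass-one boxes and the
`K`-part of the box integral contributes `∏ ν_v(K_v) ≠ 1`); `[G]` non-compact ∕ `μ` not automorphic excluded by the binders (boundedness of matrix coefficients, ★ #14bR
with `φᵢ ∈ C([G]) ⊆ L²`); the `∃ ν_∞` precedes `∀ μ ιA f φ₁ φ₂ …` ON PURPOSE (measures fixed once per `(ν, ν_v, S)`); (V5) every `∫` is against a named Haar∕product measure with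
its integrand's measurability supplied by (I), (Λ) and continuity of `t ↦ ⟨π(t)φ₁,φ₂⟩` (dominated convergence on the compact `[G]`).  No corner kill found.
Why it might fail: only if ★ `quotMatrixCoeff`'s action `t⁻¹ • x` on `[G]` were not the action by which `ιA`∕`inclPlaceAdelic` translate (it is ★ `AdelicGroupData`'s
left action throughout #13–#16), or if the trace σ-algebra on the restricted product differed from the Borel one used by `[BorelSpace G(𝔸)]` (★ `RestrictedProduct.borelSpace`,
second-countable factors — the same remark as #21s, discharged there).
[cite: CasselsFrohlichANT1967, Ch. XV (Tate) §3.3 Thm. 3.3.1] [cite: Liu2011, §2B Prop. 2.3 p. 862] [cite: GelbartPiatetskishapiroRallis1987, Part A §1, §6]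
[cite: Li1992, §3 Thm. 3.1] [cite: BorelJacquet1979, §4.1] -/
theorem sig_K2LiuDoublingPartialEuler :
    ∀ (L : Type) [Field L] [NumberField L] [IsCMField L] {N M n : ℕ} (e : Fin N × Fin M ≃ Fin n)
      (dV : Fin N → L) (hdV : ∀ i, IsCMField.complexConj L (dV i) = dV i)
      (dW : Fin M → L) (hdW : ∀ i, IsCMField.complexConj L (dW i) = dW i)
      (H : Matrix (Fin N) (Fin N) L)
      (S : Finset (HeightOneSpectrum (𝓞 (Fp L)))) [DecidableEq (HeightOneSpectrum (𝓞 (Fp L)))]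
      [MeasurableSpace (UnitaryGroup.adelicGroupData (Fp L) L (IsCMField.complexConj L) N H).Adelic]
      [BorelSpace (UnitaryGroup.adelicGroupData (Fp L) L (IsCMField.complexConj L) N H).Adelic]
      [MeasurableSpace (UnitaryGroup.arch (Fp L) L (IsCMField.complexConj L) N H)]
      [BorelSpace (UnitaryGroup.arch (Fp L) L (IsCMField.complexConj L) N H)]
      [∀ v : HeightOneSpectrum (𝓞 (Fp L)), MeasurableSpace (UnitaryGroup.localPi L (IsCMField.complexConj L) N H v)]
      [∀ v : HeightOneSpectrum (𝓞 (Fp L)), BorelSpace (UnitaryGroup.localPi L (IsCMField.complexConj L) N H v)]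
      (ν : Measure (UnitaryGroup.adelicGroupData (Fp L) L (IsCMField.complexConj L) N H).Adelic) [ν.IsHaarMeasure]
      (νv : ∀ v : HeightOneSpectrum (𝓞 (Fp L)), Measure (UnitaryGroup.localPi L (IsCMField.complexConj L) N H v))
      [∀ v, (νv v).IsHaarMeasure]
      (_hνK : ∀ v, v ∉ S →
        νv v (UnitaryGroup.localInt L (IsCMField.complexConj L) N H v : Set (UnitaryGroup.localPi L (IsCMField.complexConj L) N H v)) = 1),
      ∃ νinf : Measure (UnitaryGroup.arch (Fp L) L (IsCMField.complexConj L) N H), νinf.IsHaarMeasure ∧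
        ∀ (μ : Measure (UnitaryGroup.adelicGroupData (Fp L) L (IsCMField.complexConj L) N H).automorphicQuotient)
          [(UnitaryGroup.adelicGroupData (Fp L) L (IsCMField.complexConj L) N H).IsAutomorphicMeasure μ]
          [CompactSpace (UnitaryGroup.adelicGroupData (Fp L) L (IsCMField.complexConj L) N H).automorphicQuotient]
          (ιA : (UnitaryGroup.adelicGroupData (Fp L) L (IsCMField.complexConj L) N H).Adelic →*
            UnitaryGroup.adelic (Fp L) L (IsCMField.complexConj L) N (Matrix.diagonal dV))
          (f : HA L e dV hdV dW hdW → ℂ)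
          (φ₁ φ₂ : (UnitaryGroup.adelicGroupData (Fp L) L (IsCMField.complexConj L) N H).automorphicQuotient → ℂ)
          (_hφ₁ : Continuous φ₁) (_hφ₂ : Continuous φ₂)
          (FS : UnitaryGroup.arch (Fp L) L (IsCMField.complexConj L) N H ×
              (Π v : S, UnitaryGroup.localPi L (IsCMField.complexConj L) N H v.1) → ℂ)
          (Λ : ∀ v : HeightOneSpectrum (𝓞 (Fp L)), UnitaryGroup.localPi L (IsCMField.complexConj L) N H v → ℂ)
          (c : HeightOneSpectrum (𝓞 (Fp L)) → ℂ)
          -- (F) factorisation of the pulled-back section off `S`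
          (_hF : ∀ t : (UnitaryGroup.adelicGroupData (Fp L) L (IsCMField.complexConj L) N H).Adelic,
            f (iotaLeft L e dV hdV dW hdW (ιA t)) =
              FS (UnitaryGroup.archPart (Fp L) L (IsCMField.complexConj L) N H t,
                  fun v : S => UnitaryGroup.evalPlace (Fp L) L (IsCMField.complexConj L) N H v.1
                    (UnitaryGroup.finPart (Fp L) L (IsCMField.complexConj L) N H t)) *
                ∏ᶠ v : {v : HeightOneSpectrum (𝓞 (Fp L)) // v ∉ S},
                  Λ v.1 (UnitaryGroup.evalPlace (Fp L) L (IsCMField.complexConj L) N H v.1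
                    (UnitaryGroup.finPart (Fp L) L (IsCMField.complexConj L) N H t)))
          -- (Λ) unramified normalisation, local integrability, bounded partial Euler products of `∫|Λ_v|`
          (_hΛK : ∀ v, v ∉ S → ∀ k ∈ UnitaryGroup.localInt L (IsCMField.complexConj L) N H v, Λ v k = 1)
          (_hΛint : ∀ v, v ∉ S → Integrable (Λ v) (νv v))
          (_hΛbd : ∃ B : ℝ, ∀ T : Finset {v : HeightOneSpectrum (𝓞 (Fp L)) // v ∉ S},
            ∏ v ∈ T, ∫ g, ‖Λ v.1 g‖ ∂(νv v.1) ≤ B)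
          -- (I) the pulled-back section is continuous and integrable along `G(𝔸)`
          (_hfc : Continuous fun t => f (iotaLeft L e dV hdV dW hdW (ιA t)))
          (_hfi : Integrable (fun t => f (iotaLeft L e dV hdV dW hdW (ιA t))) ν)
          -- (K) `K^S`-sphericity of slot 1
          (_hK : ∀ t k : (UnitaryGroup.adelicGroupData (Fp L) L (IsCMField.complexConj L) N H).Adelic,
            UnitaryGroup.archPart (Fp L) L (IsCMField.complexConj L) N H k = 1 →
            (∀ v, UnitaryGroup.evalPlace (Fp L) L (IsCMField.complexConj L) N H v
                (UnitaryGroup.finPart (Fp L) L (IsCMField.complexConj L) N H k) ∈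
              UnitaryGroup.localInt L (IsCMField.complexConj L) N H v) →
            (∀ v ∈ S, UnitaryGroup.evalPlace (Fp L) L (IsCMField.complexConj L) N H v
                (UnitaryGroup.finPart (Fp L) L (IsCMField.complexConj L) N H k) = 1) →
            quotMatrixCoeff (UnitaryGroup.adelicGroupData (Fp L) L (IsCMField.complexConj L) N H) μ φ₁ φ₂ (t * k) =
              quotMatrixCoeff (UnitaryGroup.adelicGroupData (Fp L) L (IsCMField.complexConj L) N H) μ φ₁ φ₂ t)
          -- (E) local doubling-Hecke identities at every `v ∉ S`, scalar form, all translates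
          (_hE : ∀ v, v ∉ S → ∀ t : (UnitaryGroup.adelicGroupData (Fp L) L (IsCMField.complexConj L) N H).Adelic,
            localZeta (νv v) (Λ v)
                (fun g => quotMatrixCoeff (UnitaryGroup.adelicGroupData (Fp L) L (IsCMField.complexConj L) N H) μ φ₁ φ₂
                  (t * UnitaryGroup.inclPlaceAdelic (Fp L) L (IsCMField.complexConj L) N H v g)) =
              c v * quotMatrixCoeff (UnitaryGroup.adelicGroupData (Fp L) L (IsCMField.complexConj L) N H) μ φ₁ φ₂ t),
          ZetaSConverges L e dV hdV dW hdW H S νinf (fun v : S => νv v.1) μ ιA f φ₁ φ₂ ∧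
            doublingZeta L e dV hdV dW hdW (UnitaryGroup.adelicGroupData (Fp L) L (IsCMField.complexConj L) N H) ν μ ιA f φ₁ φ₂ =
              (∏' v : {v : HeightOneSpectrum (𝓞 (Fp L)) // v ∉ S}, c v.1) *
                zetaS L e dV hdV dW hdW H S νinf (fun v : S => νv v.1) μ ιA f φ₁ φ₂ :=
  K2LiuDoublingPartialEuler.doublingPartialEuler

/-- socket #30s (U5b ED. 4; organ (LS2)(d) «GL₁ SHAPE OF THE UNRAMIFIED EULER PRODUCT»; size M; PURE GL₁ ∕ `tprod` BOOKKEEPING over the places of `L` above the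
places of `L⁺` — dealable NOW to any idle seat (natural owners: the authors of the ★ GL₁ stack, K2Liu-p01 (U1′ `thetaTypePartialLPole` p854710) ∕ K2Liu-p02
(#1 `heckeEulerProductRegular` p854709)); deps ★ `Literature.NumberTheory.Automorphic.placesNotOverEquivSigma` (`{w // w ∩ 𝓞L⁺ ∉ S} ≃ Σ (v ∉ S), {w ∣ v}`,
Arthur–Clozel Ch. 3 Lem. 4.3 bookkeeping), ★ `finite_placesOver`, ★ `residueCard_eq_pow_inertiaDeg` (`q_w = q_v^{f(w|v)}`, NOT needed for the identity — the
hypothesis is stated place-of-`L`-wise), ★ `K2LiuHeckeEulerProductRegular.{hasProdLocallyUniformlyOn_partialEuler, differentiableOn_partialEuler_of_lt, partialEuler_ne_zero}`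
(unitary partial Euler products on `Re > 1`, any index set of places), Mathlib `HasProd.sigma` ∕ `Multipliable.tprod_mul` ∕ `tprod_one_add_ne_zero_of_summable`) —
**THE CONSUMER THAT PINS `c`: `∏'_{v∉S} c_v(s) = ζ^{S_L}_L(s+½) · L^{S_L}(s+½, ψ) · B^S(s)` ON `Re s > 1`, WITH `B^S(s) = ∏'_{v∉S}(1 − θ₁(v)q_v^{−(2s+2)})(1 − θ₂(v)q_v^{−(2s+1)})`
HOLOMORPHIC AND ZERO-FREE ON `Re s > 0`** [Liu2021, proof of Lem. D.1 p. 126 L8–13 (split places: `BC(π_w) ⊗ χ_{D,w}` has Satake parameters `{1, ψ_w(ϖ_w)}`);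
GR91 §3 ∕ Kudla 1994 (inert); Li1992 Thm. 3.1 (`b_n(s)`-denominator); Liu2011 (2-4)].  The PER-PLACE closed forms are HYPOTHESES in cleared form, one for every place
`v ∉ S` of `L⁺`, uniformly for split and inert `v` (the fibre `{w ∣ v}` has 2 resp. 1 elements; `q_w = q_v` resp. `q_v²`):
 (H) `c_v(s) · ∏_{w∣v} (1 − q_w^{−(s+½)})(1 − ψ_w(ϖ_w) q_w^{−(s+½)}) = (1 − θ₁(v) q_v^{−(2s+2)})(1 − θ₂(v) q_v^{−(2s+1)})` for `Re s > 0`,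
where `ψ` is a unitary Hecke character of `L` (in #34: `ψ = λ̃⁻²χ̌`, from S3's `BC(π_P)_w = {λ̃_w, λ̃_w⁻¹χ̌_w}` and `χ_D = λ̃⁻¹`, PIN (c2)) and `θ₁, θ₂ : {places of L⁺} → ℂ` are ANY
coefficient families bounded by `1` (in #34: `θ₁(v) = χ⁰(ϖ_v) := ∏_{w∣v} χ_D.valueAtUniformizer w` — `= χ_{D,w}(ϖ_w)χ_{D,w̄}(ϖ_w̄)` at split `v`, `= χ_{D,w}(ϖ_v)` at inert `v`, no
restriction-of-characters token needed — and `θ₂(v) = χ⁰(ϖ_v)·ε_{L∕L⁺}(ϖ_v)`, the coefficients of the normalising factor `b_{2,v}(s) = L_v(2s+2, χ⁰)·L_v(2s+1, χ⁰ε)` [Li1992 (3);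
Liu2011 (2-4)] — at a split `v` the right side of (H) is #28s's `Num∕a₂` verbatim).  CONCLUSION: (i) `B^S` is holomorphic and zero-free on `Re s > 0` (★ #1's M-test engine at the arguments `2s+2`, `2s+1`, `Re > 1`, coefficients bounded by `1`); (ii) for `Re s > 1`
(s23's `s₁ ≥ 1`; all three products converge absolutely there: `Re(s+½) > 1`) the family `v ↦ c_v(s)` is `Multipliable` and `∏'_{v∉S} c_v(s)` equals the tier-0 line's
★ `partialZetaL L ψ S_L (s+½)` SPELLED BY VALUE (`∏'_{w ∉ S_L} (1 − q_w^{−u})⁻¹(1 − ψ(ϖ_w)q_w^{−u})⁻¹`, `S_L := {w ∣ w ∩ 𝓞L⁺ ∈ S}` — the `S` of s23's display is this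
`S_L`, a finite set of places of `L`) times `B^S(s)`.  So in #34: `Z = (∏' c_v)·Z_S` (#29s) `= partialZetaL L ψ S_L (s+½) · r(s)` with `r := B^S · Z_S`, `r` holomorphic where
`Z_S` is (LS5∕#33s) and `r(½) = B^S(½)·Z_S(½) ≠ 0` ⟸ (i) + `Z_S(½) ≠ 0` (#31s∕#33s).
PROOF ROAD: from (H) and `E_v(s) := ∏_{w∣v}(…) ≠ 0` (`|q_w^{−u}| < 1`, `|ψ_w(ϖ_w)| = 1`) get `c_v = B_v·E_v⁻¹` on `Re s > 0`; `∏'_{w∉S_L} e_w⁻¹` is `Multipliable` with a genuine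
`HasProd` for `Re u > 1` (★ #1 engine, index set `{w ∉ S_L}`), regroup along ★ `placesNotOverEquivSigma` (`Equiv.hasProd_iff` + Mathlib `HasProd.sigma`, fibres finite ★
`finite_placesOver`) into `HasProd (v ↦ E_v⁻¹)`; `v ↦ B_v` has a `HasProd` (same engine over `L⁺` at `2s+2`, `2s+1`); multiply (`HasProd.mul`).  (i): re-run ★ #1's
Weierstrass M-test (`hasProdLocallyUniformlyOn_partialEuler`'s proof) on the NON-inverted factors with bounded coefficients: `‖(1 − θᵢ(v)q_v^{−w}) − 1‖ ≤ q_v^{−Re w}`, `Re w > 1`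
for `w ∈ {2s+1, 2s+2}`, `Re s > 0` (★ `summable_residueCard_rpow_neg`, Mathlib `Summable.hasProdLocallyUniformlyOn_one_add`, `TendstoLocallyUniformlyOn.differentiableOn`,
`tprod_one_add_ne_zero_of_summable`; each factor is non-zero since `‖θᵢ(v)q_v^{−w}‖ < 1`).
DEGENERATE-CORNER PASS: `S ⊇` all small places ∕ `S = ∅` ✓ (cofinite index either way); a fibre `{w ∣ v}` is never empty or infinite (★ `finite_placesOver`, `card_placesOver
≥ 1`) — were it empty, `∏ᶠ = 1` and (H) reads `c_v = B_v`, still consistent with (ii) (empty fibres contribute `1` to the regrouped product), so no junk either way;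
`c_v(s)` off `Re s > 0` unconstrained and unused ✓; `‖θᵢ(v)‖ > 1` (zeros ∕ divergence of `B^S`) and non-unitary `ψ` excluded by binders ✓; `Re s ≤ 1` in (ii)
excluded on purpose (at `½ < Re s ≤ 1` the `ψ`-part still converges but `ζ_L(s+½)` needs `Re s > ½`; s23 only asks `Re s > s₁ ≥ 1`) ✓; `‖θᵢ(v)‖ ≤ 1` (not `= 1`)
so that `θᵢ ≡ 0` (`B^S ≡ 1`) and finitely supported corrections are admissible instances ✓; (V5) no measure, no integral.  No corner kill found.
Why it might fail: only through a token mismatch with rev. k :256 `partialZetaL` (checked: same summand `(1 − q_w^{−u})⁻¹·(1 − ψ.valueAtUniformizer w·q_w^{−u})⁻¹`, same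
index shape `{w // w ∉ S_L}`, `u = s + 1∕2`) or if #34's `ψ, θ₁, θ₂` at an inert `v` do not satisfy (H) as displayed (the inert closed form #28i is not yet computed —
(H) is what it must deliver; if #28i's numerator at inert `v` turns out to carry `θ₂ = χ⁰ε` with `ε_v = −1` this is exactly the displayed shape, which is why `θ₂` is a
separate character and not `θ₁`).
[cite: Liu2021, proof of Lem. D.1 p. 126 L8–13] [cite: Li1992, §3 Thm. 3.1] [cite: Liu2011, §2C (2-4) p. 863] [cite: ArthurClozelAMS120, Ch. 3 Lem. 4.3] [cite: NeukirchANT1999, Ch. VII Prop. (8.1)] -/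
theorem sig_K2LiuThetaTypeDoublingEulerFactorGL1 :
    ∀ (L : Type) [Field L] [NumberField L] [IsCMField L]
      (S : Finset (HeightOneSpectrum (𝓞 (Fp L))))
      (ψ : HeckeCharacter L) (_hψ : ψ.IsUnitary)
      (θ₁ θ₂ : HeightOneSpectrum (𝓞 (Fp L)) → ℂ) (_hθ₁ : ∀ v, ‖θ₁ v‖ ≤ 1) (_hθ₂ : ∀ v, ‖θ₂ v‖ ≤ 1)
      (c : HeightOneSpectrum (𝓞 (Fp L)) → ℂ → ℂ)
      -- (H) the per-place closed forms, cleared of denominators, over the fibre `{w ∣ v}`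
      (_hc : ∀ v, v ∉ S → ∀ s : ℂ, 0 < s.re →
        c v s * ∏ᶠ w : UnitaryGroup.PlacesOver L v,
            ((1 - (w.1.residueCard : ℂ) ^ (-(s + 1 / 2))) *
              (1 - ψ.valueAtUniformizer w.1 * (w.1.residueCard : ℂ) ^ (-(s + 1 / 2)))) =
          (1 - θ₁ v * (v.residueCard : ℂ) ^ (-(2 * s + 2))) *
            (1 - θ₂ v * (v.residueCard : ℂ) ^ (-(2 * s + 1)))),
      -- (i) the normalising product `B^S` is holomorphic and zero-free on `Re s > 0`
      DifferentiableOn ℂ (fun s : ℂ => ∏' v : {v : HeightOneSpectrum (𝓞 (Fp L)) // v ∉ S},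
          ((1 - θ₁ v.1 * (v.1.residueCard : ℂ) ^ (-(2 * s + 2))) *
            (1 - θ₂ v.1 * (v.1.residueCard : ℂ) ^ (-(2 * s + 1))))) {s : ℂ | 0 < s.re} ∧
      (∀ s : ℂ, 0 < s.re →
        (∏' v : {v : HeightOneSpectrum (𝓞 (Fp L)) // v ∉ S},
          ((1 - θ₁ v.1 * (v.1.residueCard : ℂ) ^ (-(2 * s + 2))) *
            (1 - θ₂ v.1 * (v.1.residueCard : ℂ) ^ (-(2 * s + 1))))) ≠ 0) ∧
      -- (ii) the Euler product of the `c_v` is the partial GL₁ product of `L` (BY VALUE, = rev. k `partialZetaL L ψ S_L (s + 1/2)`) times `B^S`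
      ∀ s : ℂ, 1 < s.re →
        Multipliable (fun v : {v : HeightOneSpectrum (𝓞 (Fp L)) // v ∉ S} => c v.1 s) ∧
        ∏' v : {v : HeightOneSpectrum (𝓞 (Fp L)) // v ∉ S}, c v.1 s =
          (∏' w : {w : HeightOneSpectrum (𝓞 L) // w ∉ {w : HeightOneSpectrum (𝓞 L) | w.under (𝓞 (Fp L)) ∈ S}},
              ((1 - ((w.1.residueCard : ℂ) ^ (-(s + 1 / 2))))⁻¹ *
                (1 - ψ.valueAtUniformizer w.1 * ((w.1.residueCard : ℂ) ^ (-(s + 1 / 2))))⁻¹)) *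
            ∏' v : {v : HeightOneSpectrum (𝓞 (Fp L)) // v ∉ S},
              ((1 - θ₁ v.1 * (v.1.residueCard : ℂ) ^ (-(2 * s + 2))) *
                (1 - θ₂ v.1 * (v.1.residueCard : ℂ) ^ (-(2 * s + 1)))) :=
  Summit.HodgeConjecture.HodgeConjecture.Cruxes.HLiu418.K2LiuThetaTypeDoublingEulerFactorGL1.thetaTypeDoublingEulerFactorGL1 -- ★ PAID p856343 (K2Liu-p01 g3), tied ED. 5

end Summit.HodgeConjecture.HodgeConjecture.Cruxes.HLiu418.K2LiuCurveThetaSigsU5bLocalSeam
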